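import Mathlib
import Summits.Ventures.HodgeRepro.Tier4.Common.HoloForms

/-!
# Tier4/Common/HoloPositivityGlue — (T1) on the holomorphic concrete forms from the two component statements

Blind re-derivation cell `pub-hodge-repro`, Tier 4 (README §9–§10), seat t4-typer-1 (gen 0).  Target tree path
`lean/Summits/Ventures/HodgeRepro/Tier4/Common/HoloPositivityGlue.lean`.  Imports `Tier4/Common/HoloForms.lean`.

WHAT IS PROVED.  The `1`-form and `2`-form halves of the pairing of a form with itself are integrals of non-negative
real functions (`pairing_self_re_eq`, `integral_normSq_nonneg`); hence **`isPosDefOnHolo_of`**: (T1)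
`d.IsPosDefOnHolo Γ' D` follows from the two COMPONENT statements «a holomorphic bounded measurable invariant
`1`-form with `∫_D Σ_i |G_i|² = 0` is zero» and «a holomorphic bounded measurable invariant `2`-form coefficient with
`∫_D |h|² = 0` is zero» — exactly the two theorems of typer-2's `TargetPositivity` (S12119 / S12137), taken here as
hypotheses so that the glue is independent of their final names.

Nothing here says anything about the status of the Hodge conjecture for CM abelian varieties, which is NOT proved
(HC_CM is NOT proved by anyone in this repository).
-/

set_option autoImplicit false

noncomputable section

open Matrix MeasureTheory NumberField
open scoped ComplexConjugate ComplexOrder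

namespace Summit.Ventures.HodgeRepro.Tier4

/-- `∫_D f · conj f` is the real integral of `normSq ∘ f`. -/
theorem integral_mul_conj_self (D : Set (Fin 2 → ℂ)) (f : (Fin 2 → ℂ) → ℂ) :
    (∫ z in D, f z * conj (f z)) = ((∫ z in D, Complex.normSq (f z) : ℝ) : ℂ) := by
  simp_rw [Complex.mul_conj]
  exact integral_ofReal

/-- `∫_D Σ_i F_i · conj F_i` is the real integral of `Σ_i normSq (F_i)`. -/
theorem integral_inner_self (D : Set (Fin 2 → ℂ)) (F : (Fin 2 → ℂ) → (Fin 2 → ℂ)) :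
    (∫ z in D, ∑ i, F z i * conj (F z i)) = ((∫ z in D, ∑ i, Complex.normSq (F z i) : ℝ) : ℂ) := by
  simp_rw [Complex.mul_conj]
  have : (fun z => ∑ i, ((Complex.normSq (F z i) : ℝ) : ℂ)) = fun z => ((∑ i, Complex.normSq (F z i) : ℝ) : ℂ) := by
    funext z
    push_cast
    rfl
  rw [this]
  exact integral_ofReal

/-- The real part of the pairing of a pair with itself is the sum of two non-negative real integrals. -/
theorem pairingC_self_re (D : Set (Fin 2 → ℂ)) (x : FormPair) :
    (pairingC D x x).re = (∫ z in D, ∑ i, Complex.normSq (x.1 z i)) + ∫ z in D, Complex.normSq (x.2 z) := by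
  unfold pairingC pairing2
  rw [integral_inner_self, integral_mul_conj_self]
  simp

/-- The `1`-form half is non-negative. -/
theorem integral_inner_self_nonneg (D : Set (Fin 2 → ℂ)) (F : (Fin 2 → ℂ) → (Fin 2 → ℂ)) :
    0 ≤ ∫ z in D, ∑ i, Complex.normSq (F z i) :=
  integral_nonneg fun _ => Finset.sum_nonneg fun _ _ => Complex.normSq_nonneg _

/-- The `2`-form half is non-negative. -/
theorem integral_normSq_nonneg (D : Set (Fin 2 → ℂ)) (f : (Fin 2 → ℂ) → ℂ) :
    0 ≤ ∫ z in D, Complex.normSq (f z) :=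
  integral_nonneg fun _ => Complex.normSq_nonneg _

namespace TargetData

variable {F E : Type} [Field F] [NumberField F] [IsGalois ℚ F] [IsCMField F]
  [Field E] [NumberField E] [IsGalois ℚ E] [IsCMField E] (d : TargetData F E)

/-- **(T1) from its two component statements.**  If a holomorphic bounded measurable `1`-form of `X_{Γ′}` with
`∫_D Σ_i |G_i|² = 0` vanishes, and a holomorphic bounded measurable `2`-form coefficient of `X_{Γ′}` with
`∫_D |h|² = 0` vanishes, then the pairing is positive definite on the holomorphic concrete forms. -/
theorem isPosDefOnHolo_of (Γ' : Set (Matrix (Fin 3) (Fin 3) E)) (D : Set (Fin 2 → ℂ))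
    (h1 : ∀ G : (Fin 2 → ℂ) → (Fin 2 → ℂ), d.IsAutForm1 Γ' G → IsHolo1 G → IsBddMeasOn D G →
      (∫ z in D, ∑ i, G z i * conj (G z i)) = 0 → G = 0)
    (h2 : ∀ h : (Fin 2 → ℂ) → ℂ, d.IsAutForm2 Γ' h → IsHolo2 h → IsBddMeasOn D h →
      (∫ z in D, h z * conj (h z)) = 0 → h = 0) :
    d.IsPosDefOnHolo Γ' D := by
  intro x hx
  obtain ⟨⟨hA1, hA2, hB1, hB2⟩, hH1, hH2⟩ := x.2
  rw [pairingC_self_re]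
  have n1 := integral_inner_self_nonneg D x.1.1
  have n2 := integral_normSq_nonneg D x.1.2
  by_contra hle
  have hle' := not_lt.mp hle
  have e1 : (∫ z in D, ∑ i, Complex.normSq (x.1.1 z i)) = 0 := by linarith
  have e2 : (∫ z in D, Complex.normSq (x.1.2 z)) = 0 := by linarith
  have hG : x.1.1 = 0 := h1 x.1.1 hA1 hH1 hB1 (by rw [integral_inner_self, e1]; simp)
  have hh : x.1.2 = 0 := h2 x.1.2 hA2 hH2 hB2 (by rw [integral_mul_conj_self, e2]; simp)
  apply hx
  apply Subtype.ext
  exact Prod.ext hG hh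

end TargetData

end Summit.Ventures.HodgeRepro.Tier4
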